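import Summits.AtomisticToContinuum.FouriersLaw.Theses.HeatModeWeylLaw

/-!
# Birth skeleton (`Lines/birth.lean`) for crux `SineModeDiffusive` (stmt-AtomisticToContinuum-12394)

Route `HeatModeWeylLaw` (sub-problem `FouriersLaw` of `AtomisticToContinuum`), crux r3 `SineModeDiffusive` =
the FINITENESS HALF of Fourier's law read off the equilibrium sine energy mode: for
`P = pinnedChain ω₂ lam β γ` (all four `> 0`), `T > 0`, `μ = P.gibbsMeasure N T`, `K_t = P.transitionKernel N T T t`
(the CONSTRUCTED equal-temperature kernels), the Dirichlet sine mode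
`e_N = Σ_i sin(π(i+½)/N)·(p_i²/2 + U(q_i)) + Σ_{j=i+1} ½(sin_i + sin_j)·V(q_j - q_i)`, its Gibbs variance `V_N`
and centred autocorrelation `c_N(t) = ∫ ē_N · K_t ē_N dμ`:
`∃ C, ∀ N ≥ 1, ∀ t ≥ 0, (1 - C·t/N²)·V_N ≤ c_N(t)`.

## The line (registrar's birth skeleton = the route's own TWO-LAYER PLAN made checkable:
"SineModeDiffusive ⇐ CurrentNoiseBound → DynkinForModes")

SECOND-ORDER DYNKIN–KREIN DEFICIT FORMULA + GREEN–KUBO MEMORY BOUND. Write `g_N := L e_N`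
(`L = P.generator N T T`; by the local conservation law `g_N` is the `(π/N)·cos`-weighted field of bond
currents plus the two bath fluxes `γ sin(π/2N)(T - p_b²)`, `b ∈ {0, N-1}`), `Θ(q,p) = (q,-p)`.
Dynkin's identity for `e_N` (in tree for split site energies: `HonestZwanzig.pinnedChain_splitSite_dynkin`, and
`e_N` is a weighted sum of symmetrically split site energies), tested against `ē_N`, then the kernel detailed balance
`⟨f, K_u h⟩_μ = ⟨h∘Θ, K_u (f∘Θ)⟩_μ` (`HonestZwanzig.pinnedChain_corr_flip`; `e_N∘Θ = e_N`), then Dynkin for `e_N`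
again tested against `g_N∘Θ`, give the EXACT deficit formula (stub `stub_deficitFormula`)

  `V_N - c_N(t) = t·ℰ_N + ∫₀ᵗ ∫₀ᵘ Ψ_N(v) dv du`,

with the Dirichlet form `ℰ_N = -∫ ē_N g_N dμ = γT Σ_b ⟨(∂_{p_b} e_N)²⟩ = 2γT² sin²(π/2N)` (`N ≥ 2`) and the
DRIFT MEMORY `Ψ_N(v) = -∫ (g_N∘Θ)·(K_v g_N) dμ` (`≈ (π/N)²·⟨J_cos, K_v J_cos⟩`: current–current memory, the
`A e_N` part of `g_N` is momentum-odd). The crux then follows from three one-sided inputs: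
`ℰ_N ≤ B/N²` (stub `stub_dirichletFormBound`, Gaussian momenta under Gibbs),
`∫₀ᵗ∫₀ᵘ Ψ_N ≤ C₂·t/N` (stub `stub_driftMemoryDiffusive`, the HEART: the running Green–Kubo integral of the
mode-drift memory grows at most linearly in `t` with the extensive `1/N = (π/N)²·N` prefactor — normal conduction),
and `V_N ≥ v·N` (stub `stub_varianceExtensive`, law of total variance over the Gaussian momenta: `V_N ≥ N T²/4`),
by `V_N - c_N(t) ≤ (B + C₂) t/N ≤ ((B + C₂)/v)·t·V_N/N²` — `SineModeDiffusive_of`, kernel-checked below.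

## Disproof used / negatives

No `Disproof.lean` exists for this crux yet (`ledger crux ls`: no workfiles). Negatives index
(`ledger negatives --problem AtomisticToContinuum`, 20 refuted): the only Langevin-kernel entry is
`not_OddCorrectorDecay` (stmt-9139: an `N`-uniform `L¹_t` decay IN NORM of the odd part of `K_t J` is false by odd
persistence of the closed chain + bath locality). Honoured: no stub asks for decay of `‖K_v g_N‖`; the heart stub is a
bound on the SCALAR memory `⟨g_N∘Θ, K_v g_N⟩` doubly integrated in time (dephasing of correlations, which the
closed chain's unitary Koopman flow does not obstruct), and it is implied by the crux itself given the identity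
(so it is not stronger than what the route already bets on, up to `V_N = O(N)`).
Refuter crux-attack (2026-08-15, item evidence): crux SURVIVES; `t = 0` tight (`c_N(0) = V_N`).
-/

noncomputable section

open MeasureTheory Set
open scoped NNReal BigOperators

namespace Summit.AtomisticToContinuum.FouriersLaw.Cruxes.SineModeDiffusive.Birth

open Literature.MathematicalPhysics.KineticTheory.HeatConduction
open Summit.AtomisticToContinuum.FouriersLaw.Theses.HeatModeWeylLaw (SineModeDiffusive)

/-! ### Vocabulary: the crux's own sub-terms, verbatim -/

/-- The Dirichlet (`k = 1`) sine energy mode `e_N` of the pinned chain — verbatim the crux's `e N`. [folklore] -/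
def sineMode (ω₂ lam β γ : ℝ) (N : ℕ) (x : PhaseSpace N) : ℝ :=
  (∑ i : Fin N, Real.sin (Real.pi * ((i : ℝ) + 1 / 2) / N) *
      (x.2 i ^ 2 / 2 + (pinnedChain ω₂ lam β γ).U (x.1 i))) +
    ∑ i : Fin N, ∑ j : Fin N, (if j.val = i.val + 1 then
      (Real.sin (Real.pi * ((i : ℝ) + 1 / 2) / N) + Real.sin (Real.pi * ((j : ℝ) + 1 / 2) / N)) / 2 *
        (pinnedChain ω₂ lam β γ).V (x.1 j - x.1 i) else 0)

/-- The Gibbs mean `μ_T(e_N)`. [folklore] -/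
def sineMean (ω₂ lam β γ T : ℝ) (N : ℕ) : ℝ :=
  ∫ y, sineMode ω₂ lam β γ N y ∂((pinnedChain ω₂ lam β γ).gibbsMeasure N T)

/-- The Gibbs variance `V_N` of the sine mode — verbatim the crux's `V N`. [folklore] -/
def sineVar (ω₂ lam β γ T : ℝ) (N : ℕ) : ℝ :=
  ∫ x, (sineMode ω₂ lam β γ N x - sineMean ω₂ lam β γ T N) ^ 2 ∂((pinnedChain ω₂ lam β γ).gibbsMeasure N T)

/-- The centred autocorrelation `c_N(t) = ∫ ē_N · (K_t ē_N) dμ_T` — verbatim the crux's `c N t`. [folklore] -/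
def sineCorr (ω₂ lam β γ T : ℝ) (N : ℕ) (t : ℝ) : ℝ :=
  ∫ x, (sineMode ω₂ lam β γ N x - sineMean ω₂ lam β γ T N) *
      (∫ y, (sineMode ω₂ lam β γ N y - sineMean ω₂ lam β γ T N)
        ∂((pinnedChain ω₂ lam β γ).transitionKernel N T T t.toNNReal x))
    ∂((pinnedChain ω₂ lam β γ).gibbsMeasure N T)

/-- The MODE DRIFT `g_N := L e_N` (`L = P.generator N T T`, the equal-temperature Langevin generator): by the local
conservation law, the `sin`-gradient-weighted (`≈ (π/N) cos`) field of bond currents plus the two bath fluxes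
`γ sin(π/2N)(T - p_b²)`. [folklore] -/
def modeDrift (ω₂ lam β γ T : ℝ) (N : ℕ) : PhaseSpace N → ℝ :=
  (pinnedChain ω₂ lam β γ).generator N T T (sineMode ω₂ lam β γ N)

/-- The DIRICHLET FORM of the mode, `ℰ_N := -∫ ē_N · (L e_N) dμ_T` (`= γT Σ_b ∫ (∂_{p_b} e_N)² dμ_T ≥ 0`,
`= 2γT² sin²(π/2N)` for `N ≥ 2`). [folklore] -/
def dirichletForm (ω₂ lam β γ T : ℝ) (N : ℕ) : ℝ :=
  -∫ x, (sineMode ω₂ lam β γ N x - sineMean ω₂ lam β γ T N) * modeDrift ω₂ lam β γ T N x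
      ∂((pinnedChain ω₂ lam β γ).gibbsMeasure N T)

/-- The DRIFT MEMORY `Ψ_N(v) := -∫ (g_N∘Θ) · (K_v g_N) dμ_T`, `Θ(q,p) = (q,-p)`: minus the equilibrium correlation
of the mode drift at lag `v` with its time reverse (`g_N∘Θ = -A e_N + γ S e_N`), i.e. `+` the current–current
memory `⟨A e_N, K_v A e_N⟩` up to boundary-flux corrections; `Ψ_N(0) = ‖A e_N‖² - γ²‖S e_N‖²`. [folklore] -/
def driftMemory (ω₂ lam β γ T : ℝ) (N : ℕ) (v : ℝ) : ℝ :=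
  -∫ x, modeDrift ω₂ lam β γ T N (x.1, -x.2) *
      (∫ y, modeDrift ω₂ lam β γ T N y ∂((pinnedChain ω₂ lam β γ).transitionKernel N T T v.toNNReal x))
    ∂((pinnedChain ω₂ lam β γ).gibbsMeasure N T)

/-! ### The four statements of the line (named; each IS its registered stub) -/

/-- STUB 1 statement — the EXACT SECOND-ORDER DYNKIN–KREIN DEFICIT FORMULA (size L): for `N ≥ 1`, `t ≥ 0`,
`V_N - c_N(t) = t·ℰ_N + ∫₀ᵗ∫₀ᵘ Ψ_N(v) dv du`. Proof route: `c_N(t) = corr(e,e)(t)` (Markov kernels, Gibbs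
invariance `GibbsKernelInvariant`); `corr(e,e)(t) = V_N + ∫₀ᵗ corr(e, g)(u) du` (Dynkin for `e_N` by linearity from
`pinnedChain_splitSite_dynkin`, then `pinnedChain_corr_eq_cov_add_primitive`); `corr(e,g)(u) = corr(g∘Θ, e)(u)`
(`pinnedChain_corr_flip`, `e_N` even in `p`); `corr(g∘Θ,e)(u) = cov(g∘Θ,e) + ∫₀ᵘ corr(g∘Θ, g)` (primitive lemma
again); `cov(g∘Θ, e) = cov(g, e) = -ℰ_N` (`Θ`-invariance of `μ_T`) and `μ_T(g) = 0`
(`pinnedChain_integral_eq_zero_of_dynkin`). `N = 1`: one site carrying both baths, `e_1 = H_1`. [folklore] -/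
def DeficitFormula : Prop :=
  ∀ ω₂ lam β γ : ℝ, 0 < ω₂ → 0 < lam → 0 < β → 0 < γ → ∀ T : ℝ, 0 < T → ∀ N : ℕ, 1 ≤ N → ∀ t : ℝ, 0 ≤ t →
    sineVar ω₂ lam β γ T N - sineCorr ω₂ lam β γ T N t =
      t * dirichletForm ω₂ lam β γ T N +
        ∫ u in (0 : ℝ)..t, ∫ v in (0 : ℝ)..u, driftMemory ω₂ lam β γ T N v

/-- STUB 2 statement — the DIRICHLET FORM OF THE MODE IS `O(N⁻²)` (size M): `∃ B, ∀ N ≥ 1, ℰ_N ≤ B/N²`.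
Gibbs integration by parts in the bath momenta (`integral_generator_mul_gibbsDensity`): only the two thermostatted
momenta contribute, `ℰ_N = γT(sin²(π/2N)⟨p_0²⟩ + sin²(π(N-½)/N)⟨p_{N-1}²⟩) = 2γT² sin²(π/2N) ≤ γT²π²/(2N²)`
(`N ≥ 2`; `N = 1`: `ℰ_1 = 2γT²`). [folklore] -/
def DirichletFormBound : Prop :=
  ∀ ω₂ lam β γ : ℝ, 0 < ω₂ → 0 < lam → 0 < β → 0 < γ → ∀ T : ℝ, 0 < T →
    ∃ B : ℝ, ∀ N : ℕ, 1 ≤ N → dirichletForm ω₂ lam β γ T N ≤ B / (N : ℝ) ^ 2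

/-- STUB 3 statement — the DRIFT MEMORY IS DIFFUSIVE (the HEART, size XL): `∃ C₂, ∀ N ≥ 1, ∀ t ≥ 0,
∫₀ᵗ∫₀ᵘ Ψ_N(v) dv du ≤ C₂·t/N`. Expected mechanism: the running Green–Kubo integral `∫₀ᵘ Ψ_N = -ℰ_N - c_N'(u)` is
bounded by `C₂/N` uniformly in `u` (the `(π/N)²`-weighted current–current memory of `N` bonds is integrable in time,
uniformly in `N`: normal conduction of the pinned anharmonic chain), which integrates to the claim. False for the
harmonic member (ballistic: `∫₀ᵗ∫₀ᵘ Ψ ≍ t²/N` up to `t ≍ N`) — the anharmonicity `lam, β > 0` is load-bearing here and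
only here. [folklore] -/
def DriftMemoryDiffusive : Prop :=
  ∀ ω₂ lam β γ : ℝ, 0 < ω₂ → 0 < lam → 0 < β → 0 < γ → ∀ T : ℝ, 0 < T →
    ∃ C₂ : ℝ, ∀ N : ℕ, 1 ≤ N → ∀ t : ℝ, 0 ≤ t →
      ∫ u in (0 : ℝ)..t, ∫ v in (0 : ℝ)..u, driftMemory ω₂ lam β γ T N v ≤ C₂ * t / (N : ℝ)

/-- STUB 4 statement — the MODE VARIANCE IS EXTENSIVE FROM BELOW (size M): `∃ v > 0, ∀ N ≥ 1, v·N ≤ V_N`.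
Under `μ_T` momenta and positions are independent and the `p_i` are i.i.d. `N(0,T)`, so
`V_N ≥ Var(Σ_i sin_i p_i²/2) = (T²/2) Σ_i sin²(π(i+½)/N) = N T²/4` (`N ≥ 2`; `= T²/2` at `N = 1`). [folklore] -/
def VarianceExtensive : Prop :=
  ∀ ω₂ lam β γ : ℝ, 0 < ω₂ → 0 < lam → 0 < β → 0 < γ → ∀ T : ℝ, 0 < T →
    ∃ v : ℝ, 0 < v ∧ ∀ N : ℕ, 1 ≤ N → v * (N : ℝ) ≤ sineVar ω₂ lam β γ T N

/-! ### Registered stubs -/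

/-- STUB 1 (size L). [folklore] -/
theorem stub_deficitFormula : DeficitFormula := by
  sorry

/-- STUB 2 (size M). [folklore] -/
theorem stub_dirichletFormBound : DirichletFormBound := by
  sorry

/-- STUB 3 (size XL, hardest). [folklore] -/
theorem stub_driftMemoryDiffusive : DriftMemoryDiffusive := by
  sorry

/-- STUB 4 (size M). [folklore] -/
theorem stub_varianceExtensive : VarianceExtensive := by
  sorry

/-! ### The composition: the crux BY NAME from the four stub statements -/

/-- Read-back: the crux `SineModeDiffusive` is literally the statement over this file's vocabulary. [folklore] -/
theorem sineModeDiffusive_iff :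
    SineModeDiffusive ↔
      ∀ ω₂ lam β γ : ℝ, 0 < ω₂ → 0 < lam → 0 < β → 0 < γ → ∀ T : ℝ, 0 < T →
        ∃ C : ℝ, ∀ N : ℕ, 1 ≤ N → ∀ t : ℝ, 0 ≤ t →
          (1 - C * t / (N : ℝ) ^ 2) * sineVar ω₂ lam β γ T N ≤ sineCorr ω₂ lam β γ T N t :=
  Iff.rfl

/-- **The composition, hypothesis form** (the real proof; conclusion = the read-back statement of the crux over this
file's vocabulary, so that exactly ONE theorem of the file — `SineModeDiffusive_of` below — concludes the crux by name):
with `B, C₂, v` from stubs 2–4 take `C := (B⁺ + C₂⁺)/v`; for `N ≥ 1`, `t ≥ 0` the deficit formula gives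
`V_N - c_N(t) = tℰ_N + ∫∫Ψ_N ≤ B⁺t/N² + C₂⁺t/N ≤ (B⁺ + C₂⁺)·t/N ≤ C·t·V_N/N²` since `N ≤ V_N/v`. [folklore] -/
theorem sineModeDiffusive_of_hyps (h1 : DeficitFormula) (h2 : DirichletFormBound) (h3 : DriftMemoryDiffusive)
    (h4 : VarianceExtensive) :
    ∀ ω₂ lam β γ : ℝ, 0 < ω₂ → 0 < lam → 0 < β → 0 < γ → ∀ T : ℝ, 0 < T →
      ∃ C : ℝ, ∀ N : ℕ, 1 ≤ N → ∀ t : ℝ, 0 ≤ t →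
        (1 - C * t / (N : ℝ) ^ 2) * sineVar ω₂ lam β γ T N ≤ sineCorr ω₂ lam β γ T N t := by
  intro ω₂ lam β γ hω hl hβ hγ T hT
  obtain ⟨B, hB⟩ := h2 ω₂ lam β γ hω hl hβ hγ T hT
  obtain ⟨C₂, hC₂⟩ := h3 ω₂ lam β γ hω hl hβ hγ T hT
  obtain ⟨v, hv, hvN⟩ := h4 ω₂ lam β γ hω hl hβ hγ T hT
  refine ⟨(max B 0 + max C₂ 0) / v, fun N hN t ht => ?_⟩
  have hid := h1 ω₂ lam β γ hω hl hβ hγ T hT N hN t ht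
  have hE := hB N hN
  have hI := hC₂ N hN t ht
  have hV := hvN N hN
  -- abbreviations
  set K : ℝ := max B 0 + max C₂ 0 with hK
  set V : ℝ := sineVar ω₂ lam β γ T N with hVdef
  set c : ℝ := sineCorr ω₂ lam β γ T N t with hcdef
  set E : ℝ := dirichletForm ω₂ lam β γ T N with hEdef
  set I : ℝ := ∫ u in (0 : ℝ)..t, ∫ s in (0 : ℝ)..u, driftMemory ω₂ lam β γ T N s with hIdef
  have hN1 : (1 : ℝ) ≤ (N : ℝ) := by exact_mod_cast hN
  have hNpos : (0 : ℝ) < (N : ℝ) := by linarith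
  have hK0 : 0 ≤ K := add_nonneg (le_max_right B 0) (le_max_right C₂ 0)
  -- (a) the Dirichlet-form term: `t ℰ_N ≤ B⁺ t / N`
  have hE1 : E ≤ max B 0 / (N : ℝ) := by
    have h1' : E ≤ max B 0 / (N : ℝ) ^ 2 :=
      hE.trans (div_le_div_of_nonneg_right (le_max_left B 0) (by positivity))
    have h2' : max B 0 / (N : ℝ) ^ 2 ≤ max B 0 / (N : ℝ) := by
      apply div_le_div_of_nonneg_left (le_max_right B 0) hNpos
      nlinarith
    exact h1'.trans h2'
  have hEt : t * E ≤ max B 0 * t / (N : ℝ) := by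
    calc t * E ≤ t * (max B 0 / (N : ℝ)) := mul_le_mul_of_nonneg_left hE1 ht
      _ = max B 0 * t / (N : ℝ) := by ring
  -- (b) the memory term: `∫∫Ψ ≤ C₂⁺ t / N`
  have hIt : I ≤ max C₂ 0 * t / (N : ℝ) := by
    calc I ≤ C₂ * t / (N : ℝ) := hI
      _ ≤ max C₂ 0 * t / (N : ℝ) :=
          div_le_div_of_nonneg_right (mul_le_mul_of_nonneg_right (le_max_left C₂ 0) ht) hNpos.le
  -- (c) the deficit: `V - c ≤ K t / N`
  have hdef : V - c ≤ K * t / (N : ℝ) := by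
    rw [hid]
    calc t * E + I ≤ max B 0 * t / (N : ℝ) + max C₂ 0 * t / (N : ℝ) := add_le_add hEt hIt
      _ = K * t / (N : ℝ) := by rw [hK]; ring
  -- (d) extensivity: `K t / N ≤ (K/v) · t / N² · V` because `v N ≤ V`
  have hone : 1 ≤ V / (v * (N : ℝ)) := by
    rw [one_le_div (by positivity)]
    exact hV
  have hKt : 0 ≤ K * t / (N : ℝ) := by positivity
  have hkey : K * t / (N : ℝ) ≤ K / v * t / (N : ℝ) ^ 2 * V := by
    have hrw : K / v * t / (N : ℝ) ^ 2 * V = (K * t / (N : ℝ)) * (V / (v * (N : ℝ))) := by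
      field_simp
    rw [hrw]
    exact le_mul_of_one_le_right hKt hone
  -- conclude
  have hexp : (1 - K / v * t / (N : ℝ) ^ 2) * V = V - K / v * t / (N : ℝ) ^ 2 * V := by ring
  rw [hexp]
  linarith [hdef, hkey]

/-- **The crux, by name, from the four registered stubs** (kernel-checked composition; the only `sorry`s in its closure
are the four declared stubs): `SineModeDiffusive_of = sineModeDiffusive_iff.mpr (sineModeDiffusive_of_hyps stub₁ … stub₄)`.
[folklore] -/
theorem SineModeDiffusive_of : SineModeDiffusive :=
  sineModeDiffusive_iff.mpr
    (sineModeDiffusive_of_hyps stub_deficitFormula stub_dirichletFormBound stub_driftMemoryDiffusive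
      stub_varianceExtensive)

end Summit.AtomisticToContinuum.FouriersLaw.Cruxes.SineModeDiffusive.Birth

end
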